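import Literature.NumberTheory.EllipticCurves.BinaryQuarticForms
import HarnessLib

/-!
# Proofs for `BinaryQuarticForms`: Bhargava–Shankar Thm 1.7 (eligible invariants), heights

Topic `Literature/NumberTheory/EllipticCurves`; sibling proof file of `BinaryQuarticForms.lean`
(vocabulary of M. Bhargava, A. Shankar, *Binary quartic forms having bounded invariants, and the
boundedness of the average rank of elliptic curves*, Ann. of Math. (2) 181 (2015) 191–242).

* `Literature.NumberTheory.EllipticCurves.bhargavaShankar_eligible_iff_holds` — **Thm 1.7 proved**: `(I, J) ∈ ℤ²` occurs as the
  invariants of an integral binary quartic form iff (a) `I ≡ 0 (3)`, `J ≡ 0 (27)`, or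
  (b) `I ≡ 1 (9)`, `J ≡ ±2 (27)`, or (c) `I ≡ 4 (9)`, `J ≡ ±16 (27)`, or (d) `I ≡ 7 (9)`,
  `J ≡ ±7 (27)`. The source deduces this from the parametrization of monogenised cubic rings
  (held arXiv text: Lemma 2.9 via Prop. 3.2); the proof here is the direct elementary one:
  with `c` the `x²y²`-coefficient, `I ≡ c² (mod 3)` and `J ≡ c³ − 3cI (mod 27)` identically
  (`nine_mul_c_sq_sub_I`, `J_sub_eq`), which forces (a)–(d) by a finite check in `ℤ/27`
  (`eligible_key`, `decide`); conversely `f = x³y + c x²y² + d xy³ + e y⁴` with `c ∈ {0, ±1}`,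
  `d = (c² − I)/3`, `e = (c³ − 3cI − J)/27` realises every eligible pair
  (`exists_invariants_eq`).
* `Literature.NumberTheory.EllipticCurves.BinaryQuartic.GL2ZEquiv.pgl2Equiv_map`: `GL₂(ℤ)`-equivalent integral forms are
  `PGL₂(ℚ)`-equivalent (the twist `det(γ)⁻²` is `1` for `det γ = ±1`).
* Invariance API: `disc_subst` (`Δ(γ·f) = det(γ)¹² Δ(f)`), `GL2ZEquiv.disc_eq`,
  `isSoluble_subst_iff`, `isSoluble_smul_sq_iff`, `PGL2Equiv.isSoluble_iff`,
  `isDefinite_subst_iff`, `GL2ZEquiv.mem_noRealRoots_iff/mem_twoRealRoots_iff/mem_fourRealRoots_iff`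
  (the real types `V_ℤ^{(i)}` are `GL₂(ℤ)`-invariant), `GL2ZEquiv.isLocallySoluble_iff`.
* `Literature.NumberTheory.EllipticCurves.BinaryQuartic.invariants_identityQuartic`: `4x³y + 4A xy³ + 4B y⁴` has invariants
  `2⁴ I(E_{A,B})`, `2⁶ J(E_{A,B})` (the identity Selmer class; non-vacuity of Thm 5.6's set).
* `Literature.NumberTheory.EllipticCurves.BinaryQuartic.height_eq_of_invariants_eq`: a form with the invariants `2⁴ I(E)`, `2⁶ J(E)`
  of `E = E_{A,B}` (`I(E) = −3A`, `J(E) = −27B`) has height `2¹⁰ · 27 · H(E_{A,B})`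
  (`Literature.NumberTheory.EllipticCurves.naiveHeight`), i.e. the source's `H(f) = 2¹² H'(E)`, `27 H(E) = 4 H'(E)`.

## References

* [BhargavaShankarAnnals2015] Bhargava–Shankar, Ann. of Math. (2) 181 (2015) 191–242,
  doi:10.4007/annals.2015.181.1.3 = arXiv:1006.1002: Thm 1.7 (§1.2); §5 p. 31 of the arXiv text
  (heights `H`, `H'`).
-/

noncomputable section

open scoped Classical

namespace Literature.NumberTheory.EllipticCurves

namespace BinaryQuartic

/-! ## Bhargava–Shankar Thm 1.7: which `(I, J)` are invariants of an integral binary quartic form -/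

/-- `9 (c² − I(f)) = 27 (bd − 4ae)`: in particular `I(f) ≡ c² (mod 3)` (elementary, from
`I = 12ae − 3bd + c²`). [folklore] -/
theorem nine_mul_c_sq_sub_I (f : BinaryQuartic ℤ) :
    9 * (f.c ^ 2 - f.I) = 27 * (f.b * f.d - 4 * f.a * f.e) := by
  simp only [I]; ring

/-- `J(f) − (c³ − 3c·I(f)) = 27 (4ace − ad² − eb²)`: in particular `J(f) ≡ c³ − 3c I(f) (mod 27)`
(elementary, from the formulas for `I`, `J`). [folklore] -/
theorem J_sub_eq (f : BinaryQuartic ℤ) :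
    f.J - (f.c ^ 3 - 3 * f.c * f.I) = 27 * (4 * f.a * f.c * f.e - f.a * f.d ^ 2 - f.e * f.b ^ 2) := by
  simp only [I, J]; ring

/-- The finite check behind the "only if" direction of Thm 1.7, in `ℤ/27`: if `9(c² − i) = 0`
(i.e. `i ≡ c²` mod `3`) and `j = c³ − 3ci`, then `(i, j)` satisfies one of the congruences
(a)–(d), written in `ℤ/27` (`9i = 0` iff `3 ∣ I`; `3(i − 1) = 0` iff `I ≡ 1 (mod 9)`, etc.).
[folklore] -/
theorem eligible_key (c i : ZMod 27) (h : 9 * (c ^ 2 - i) = 0) :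
    (9 * i = 0 ∧ c ^ 3 - 3 * c * i = 0) ∨
      (3 * (i - 1) = 0 ∧ (c ^ 3 - 3 * c * i = 2 ∨ c ^ 3 - 3 * c * i = -2)) ∨
      (3 * (i - 4) = 0 ∧ (c ^ 3 - 3 * c * i = 16 ∨ c ^ 3 - 3 * c * i = -16)) ∨
      (3 * (i - 7) = 0 ∧ (c ^ 3 - 3 * c * i = 7 ∨ c ^ 3 - 3 * c * i = -7)) := by
  revert c i h
  decide

/-- Casting lemma: `((27 k : ℤ) : ℤ/27) = 0`. [folklore] -/
theorem intCast_twentySeven_mul (k : ℤ) : ((27 * k : ℤ) : ZMod 27) = 0 := by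
  rw [ZMod.intCast_zmod_eq_zero_iff_dvd]
  exact ⟨k, by push_cast; ring⟩

/-- From `ℤ/27` back to congruences: `9 · I = 0` in `ℤ/27` iff `I ≡ 0 (mod 3)`. [folklore] -/
theorem nine_mul_intCast_eq_zero_iff (I : ℤ) : (9 * (I : ZMod 27)) = 0 ↔ I ≡ 0 [ZMOD 3] := by
  rw [show (9 * (I : ZMod 27)) = ((9 * I : ℤ) : ZMod 27) by push_cast; ring,
    ZMod.intCast_zmod_eq_zero_iff_dvd, Int.modEq_zero_iff_dvd]
  constructor
  · rintro ⟨k, hk⟩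
    exact ⟨k, by push_cast at hk; linarith⟩
  · rintro ⟨k, hk⟩
    exact ⟨k, by rw [hk]; push_cast; ring⟩

/-- From `ℤ/27` back to congruences: `3 (I − r) = 0` in `ℤ/27` iff `I ≡ r (mod 9)`. [folklore] -/
theorem three_mul_intCast_sub_eq_zero_iff (I r : ℤ) :
    (3 * ((I : ZMod 27) - r)) = 0 ↔ I ≡ r [ZMOD 9] := by
  rw [show (3 * ((I : ZMod 27) - r)) = ((3 * (I - r) : ℤ) : ZMod 27) by push_cast; ring,
    ZMod.intCast_zmod_eq_zero_iff_dvd, Int.modEq_iff_dvd]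
  constructor
  · rintro ⟨k, hk⟩
    exact ⟨-k, by push_cast at hk; linarith⟩
  · rintro ⟨k, hk⟩
    exact ⟨-k, by push_cast; linarith⟩

/-- `3 (I − 1) = 0` in `ℤ/27` iff `I ≡ 1 (mod 9)`. [folklore] -/
theorem three_mul_intCast_sub_one_eq_zero_iff (I : ℤ) :
    (3 * ((I : ZMod 27) - 1)) = 0 ↔ I ≡ 1 [ZMOD 9] := by
  simpa using three_mul_intCast_sub_eq_zero_iff I 1

/-- `3 (I − 4) = 0` in `ℤ/27` iff `I ≡ 4 (mod 9)`. [folklore] -/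
theorem three_mul_intCast_sub_four_eq_zero_iff (I : ℤ) :
    (3 * ((I : ZMod 27) - 4)) = 0 ↔ I ≡ 4 [ZMOD 9] := by
  simpa using three_mul_intCast_sub_eq_zero_iff I 4

/-- `3 (I − 7) = 0` in `ℤ/27` iff `I ≡ 7 (mod 9)`. [folklore] -/
theorem three_mul_intCast_sub_seven_eq_zero_iff (I : ℤ) :
    (3 * ((I : ZMod 27) - 7)) = 0 ↔ I ≡ 7 [ZMOD 9] := by
  simpa using three_mul_intCast_sub_eq_zero_iff I 7

/-- **"Only if" direction of Bhargava–Shankar Thm 1.7**: the invariants `(I(f), J(f))` of every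
integral binary quartic form satisfy one of the congruences (a)–(d) of Thm 1.7. Proof: with
`c` the middle coefficient, `I ≡ c² (mod 3)` and `J ≡ c³ − 3cI (mod 27)` (`nine_mul_c_sq_sub_I`,
`J_sub_eq`), and a finite check modulo `27` (`eligible_key`).
[cite: BhargavaShankarAnnals2015, Thm 1.7] -/
theorem eligible_of_invariants (f : BinaryQuartic ℤ) :
    (f.I ≡ 0 [ZMOD 3] ∧ f.J ≡ 0 [ZMOD 27]) ∨
      (f.I ≡ 1 [ZMOD 9] ∧ (f.J ≡ 2 [ZMOD 27] ∨ f.J ≡ -2 [ZMOD 27])) ∨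
      (f.I ≡ 4 [ZMOD 9] ∧ (f.J ≡ 16 [ZMOD 27] ∨ f.J ≡ -16 [ZMOD 27])) ∨
      (f.I ≡ 7 [ZMOD 9] ∧ (f.J ≡ 7 [ZMOD 27] ∨ f.J ≡ -7 [ZMOD 27])) := by
  have h9 : (9 * (((f.c : ℤ) : ZMod 27) ^ 2 - (f.I : ZMod 27))) = 0 := by
    rw [show (9 * (((f.c : ℤ) : ZMod 27) ^ 2 - (f.I : ZMod 27))) = ((9 * (f.c ^ 2 - f.I) : ℤ) :
      ZMod 27) by push_cast; ring, nine_mul_c_sq_sub_I, intCast_twentySeven_mul]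
  have hJ : ((f.c : ℤ) : ZMod 27) ^ 3 - 3 * (f.c : ZMod 27) * (f.I : ZMod 27) = (f.J : ZMod 27) := by
    have h := J_sub_eq f
    rw [sub_eq_iff_eq_add] at h
    have h27 : (27 : ZMod 27) = 0 := by decide
    rw [h]
    push_cast
    rw [h27, zero_mul, zero_add]
  have key := eligible_key (f.c : ZMod 27) (f.I : ZMod 27) h9
  rw [hJ] at key
  simp only [nine_mul_intCast_eq_zero_iff, three_mul_intCast_sub_one_eq_zero_iff,
    three_mul_intCast_sub_four_eq_zero_iff, three_mul_intCast_sub_seven_eq_zero_iff] at key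
  rcases key with ⟨hI, hJ0⟩ | ⟨hI, hJ0⟩ | ⟨hI, hJ0⟩ | ⟨hI, hJ0⟩
  · refine Or.inl ⟨hI, ?_⟩
    rw [← Int.cast_zero (R := ZMod 27)] at hJ0
    exact (ZMod.intCast_eq_intCast_iff _ _ 27).mp hJ0
  · refine Or.inr (Or.inl ⟨hI, ?_⟩)
    rcases hJ0 with h | h
    · left; exact (ZMod.intCast_eq_intCast_iff f.J 2 27).mp (by rw [h]; push_cast; rfl)
    · right; exact (ZMod.intCast_eq_intCast_iff f.J (-2) 27).mp (by rw [h]; push_cast; rfl)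
  · refine Or.inr (Or.inr (Or.inl ⟨hI, ?_⟩))
    rcases hJ0 with h | h
    · left; exact (ZMod.intCast_eq_intCast_iff f.J 16 27).mp (by rw [h]; push_cast; rfl)
    · right; exact (ZMod.intCast_eq_intCast_iff f.J (-16) 27).mp (by rw [h]; push_cast; rfl)
  · refine Or.inr (Or.inr (Or.inr ⟨hI, ?_⟩))
    rcases hJ0 with h | h
    · left; exact (ZMod.intCast_eq_intCast_iff f.J 7 27).mp (by rw [h]; push_cast; rfl)
    · right; exact (ZMod.intCast_eq_intCast_iff f.J (-7) 27).mp (by rw [h]; push_cast; rfl)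

/-- **"If" direction of Bhargava–Shankar Thm 1.7**, with explicit witnesses: every pair `(I, J)`
satisfying one of the congruences (a)–(d) is `(I(f), J(f))` for a form
`f = x³y + c x²y² + d xy³ + e y⁴` with `c ∈ {0, 1, −1}`, `d = (c² − I)/3`, `e = (c³ − 3cI − J)/27`
(for `a = 0`, `b = 1` one has `I = c² − 3d`, `J = 9cd − 27e − 2c³`).
[cite: BhargavaShankarAnnals2015, Thm 1.7] -/
theorem exists_invariants_eq {I J : ℤ}
    (h : (I ≡ 0 [ZMOD 3] ∧ J ≡ 0 [ZMOD 27]) ∨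
      (I ≡ 1 [ZMOD 9] ∧ (J ≡ 2 [ZMOD 27] ∨ J ≡ -2 [ZMOD 27])) ∨
      (I ≡ 4 [ZMOD 9] ∧ (J ≡ 16 [ZMOD 27] ∨ J ≡ -16 [ZMOD 27])) ∨
      (I ≡ 7 [ZMOD 9] ∧ (J ≡ 7 [ZMOD 27] ∨ J ≡ -7 [ZMOD 27]))) :
    ∃ f : BinaryQuartic ℤ, f.I = I ∧ f.J = J := by
  rcases h with ⟨hI, hJ⟩ | ⟨hI, hJ | hJ⟩ | ⟨hI, hJ | hJ⟩ | ⟨hI, hJ | hJ⟩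
  · obtain ⟨k, hk⟩ := Int.modEq_zero_iff_dvd.mp hI
    obtain ⟨m, hm⟩ := Int.modEq_zero_iff_dvd.mp hJ
    exact ⟨⟨0, 1, 0, -k, -m⟩, by simp only [BinaryQuartic.I]; linear_combination -hk,
      by simp only [BinaryQuartic.J]; linear_combination -hm⟩
  all_goals
    obtain ⟨k, hk⟩ := Int.modEq_iff_dvd.mp hI
    obtain ⟨m, hm⟩ := Int.modEq_iff_dvd.mp hJ
  · exact ⟨⟨0, 1, -1, 3 * k, m - k⟩, by simp only [BinaryQuartic.I]; linear_combination hk,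
      by simp only [BinaryQuartic.J]; linear_combination hm⟩
  · exact ⟨⟨0, 1, 1, 3 * k, k + m⟩, by simp only [BinaryQuartic.I]; linear_combination hk,
      by simp only [BinaryQuartic.J]; linear_combination hm⟩
  · exact ⟨⟨0, 1, 1, 3 * k - 1, k + m - 1⟩, by simp only [BinaryQuartic.I]; linear_combination hk,
      by simp only [BinaryQuartic.J]; linear_combination hm⟩
  · exact ⟨⟨0, 1, -1, 3 * k - 1, 1 - k + m⟩, by simp only [BinaryQuartic.I]; linear_combination hk,
      by simp only [BinaryQuartic.J]; linear_combination hm⟩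
  · exact ⟨⟨0, 1, 1, 3 * k - 2, k + m - 1⟩, by simp only [BinaryQuartic.I]; linear_combination hk,
      by simp only [BinaryQuartic.J]; linear_combination hm⟩
  · exact ⟨⟨0, 1, -1, 3 * k - 2, 1 - k + m⟩, by simp only [BinaryQuartic.I]; linear_combination hk,
      by simp only [BinaryQuartic.J]; linear_combination hm⟩

end BinaryQuartic

/-- **Bhargava–Shankar, Thm 1.7, proved** (Ann. of Math. 181 (2015), §1.2): a pair
`(I, J) ∈ ℤ × ℤ` occurs as the invariants of an integral binary quartic form iff it satisfies one
of the congruences (a) `I ≡ 0 (3)`, `J ≡ 0 (27)`; (b) `I ≡ 1 (9)`, `J ≡ ±2 (27)`; (c) `I ≡ 4 (9)`,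
`J ≡ ±16 (27)`; (d) `I ≡ 7 (9)`, `J ≡ ±7 (27)`. Discharge of the named fact
`Literature.NumberTheory.EllipticCurves.bhargavaShankar_eligible_iff` (`BinaryQuarticForms.lean`): necessity by
`BinaryQuartic.eligible_of_invariants` (`I ≡ c²` mod `3`, `J ≡ c³ − 3cI` mod `27`, finite check),
sufficiency by the explicit forms of `BinaryQuartic.exists_invariants_eq`. (The source derives
the theorem from the parametrization of monogenised cubic rings; this direct argument is
elementary.) [cite: BhargavaShankarAnnals2015, Thm 1.7] -/
theorem bhargavaShankar_eligible_iff_holds : bhargavaShankar_eligible_iff := by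
  intro I J
  constructor
  · rintro ⟨f, rfl, rfl⟩
    exact BinaryQuartic.eligible_of_invariants f
  · exact BinaryQuartic.exists_invariants_eq


namespace BinaryQuartic

/-! ## Heights of forms attached to `E_{A,B}` -/

/-- For an integral form with the invariants `2⁴ I(E)`, `2⁶ J(E)` of `E = E_{A,B}` (`I(E) = −3A`,
`J(E) = −27B`), the height is `H(f) = 2¹⁰ · 27 · H(E_{A,B})` with `H(E_{A,B}) = max(4|A|³, 27B²)`
the naive height of the tree (`Literature.NumberTheory.EllipticCurves.naiveHeight`): Bhargava–Shankar's `H(f) = 2¹² H'(E)` and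
`27 H(E) = 4 H'(E)` (held arXiv text, §5, p. 31). [cite: BhargavaShankarAnnals2015, §5 (H and H'; arXiv:1006.1002v2 numbering)] -/
theorem height_eq_of_invariants_eq {f : BinaryQuartic ℤ} {A B : ℤ} (hI : f.I = 2 ^ 4 * (-3 * A))
    (hJ : f.J = 2 ^ 6 * (-27 * B)) : f.height = 2 ^ 10 * 27 * (naiveHeight (A, B) : ℝ) := by
  simp only [height, heightIJ, hI, hJ, naiveHeight, Int.cast_max]
  push_cast
  rw [mul_max_of_nonneg _ _ (by positivity)]
  have hA : |(16 : ℝ) * (-3 * (A : ℝ))| = 48 * |(A : ℝ)| := by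
    rw [abs_mul, abs_mul, abs_neg]; norm_num; ring
  rw [hA]
  congr 1 <;> ring

end BinaryQuartic


namespace BinaryQuartic

/-! ## `GL₂(ℤ)`-equivalent integral forms are `PGL₂(ℚ)`-equivalent -/

/-- A `GL₂(ℤ)`-equivalence of integral forms is, after extension of scalars to `ℚ`, a
`PGL₂(ℚ)`-equivalence for the twisted action (for `det γ = ±1` the twist `det(γ)⁻²` is `1`):
each `PGL₂(ℚ)`-class of integral forms is a union of `GL₂(ℤ)`-orbits (Bhargava–Shankar, held
arXiv text §3.3: "for `R = ℤ` the [twisted] action is the same as the non-twisted action"; §5.2).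
[cite: BhargavaShankarAnnals2015, §3.3 p. 15 (arXiv:1006.1002v2 numbering)] -/
theorem GL2ZEquiv.pgl2Equiv_map {f g : BinaryQuartic ℤ} (h : GL2ZEquiv f g) :
    PGL2Equiv (f.map (Int.castRingHom ℚ)) (g.map (Int.castRingHom ℚ)) := by
  obtain ⟨γ, hγ, rfl⟩ := h
  have hdet : (γ.map (Int.castRingHom ℚ)).det = (γ.det : ℚ) := by
    rw [show γ.map (Int.castRingHom ℚ) = (Int.castRingHom ℚ).mapMatrix γ from rfl,
      ← RingHom.map_det]; rfl
  have hsq : (γ.map (Int.castRingHom ℚ)).det ^ 2 = 1 := by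
    rw [hdet]
    rcases Int.isUnit_iff.mp hγ with h1 | h1 <;> simp [h1]
  refine ⟨γ.map (Int.castRingHom ℚ), ?_, ?_⟩
  · intro h0
    rw [h0] at hsq
    norm_num at hsq
  · rw [map_subst, hsq, inv_one, one_smul]

end BinaryQuartic


namespace BinaryQuartic

/-! ## Invariance of the discriminant, definiteness and solubility under substitutions -/

/-- Relative invariance of the discriminant, `Δ(γ · f) = (det γ)¹² Δ(f)`, over a domain of
characteristic zero (from `27Δ = 4I³ − J²` and the relative invariance of `I`, `J`;
Bhargava–Shankar 2015, §2 p. 8: `Δ` "being a relative invariant of degree 6" in the coefficients).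
[cite: BhargavaShankarAnnals2015, §2 p. 8] -/
theorem disc_subst {R : Type*} [CommRing R] [IsDomain R] [CharZero R] (f : BinaryQuartic R)
    (γ : Matrix (Fin 2) (Fin 2) R) : (f.subst γ).disc = γ.det ^ 12 * f.disc := by
  have h27 : (27 : R) ≠ 0 := by norm_num
  apply mul_left_cancel₀ h27
  rw [twentySeven_mul_disc, I_subst, J_subst, mul_left_comm, twentySeven_mul_disc]
  ring

/-- `GL₂(ℤ)`-equivalent forms have the same discriminant (`det γ = ±1`). [folklore] -/
theorem GL2ZEquiv.disc_eq {f g : BinaryQuartic ℤ} (h : GL2ZEquiv f g) : g.disc = f.disc := by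
  obtain ⟨γ, hγ, rfl⟩ := h
  have h2 : γ.det ^ 2 = 1 := by
    rcases Int.isUnit_iff.mp hγ with h | h <;> simp [h]
  rw [disc_subst, show (12 : ℕ) = 2 * 6 from rfl, pow_mul, h2, one_pow, one_mul]

/-- Solubility of `z² = f(x,y)` is invariant under invertible substitutions: if `γ` is invertible
then `f.subst γ` is `K`-soluble iff `f` is (the substitution `(x,y) ↦ (x,y)γ` is a bijection of
`K² ∖ {0}`). [folklore] -/
theorem isSoluble_subst_iff {K : Type*} [Field K] (f : BinaryQuartic K)
    {γ : Matrix (Fin 2) (Fin 2) K} (hγ : γ.det ≠ 0) : (f.subst γ).IsSoluble ↔ f.IsSoluble := by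
  have key : ∀ (g : BinaryQuartic K) (δ : Matrix (Fin 2) (Fin 2) K), δ.det ≠ 0 →
      (g.subst δ).IsSoluble → g.IsSoluble := by
    rintro g δ hδ ⟨x, y, z, hxy, hz⟩
    refine ⟨x * δ 0 0 + y * δ 1 0, x * δ 0 1 + y * δ 1 1, z, ?_, by rw [hz, eval_subst]⟩
    by_contra h0
    simp only [ne_eq, not_or, not_not] at h0
    obtain ⟨h1, h2⟩ := h0
    -- `(x, y) δ = 0` with `det δ ≠ 0` forces `(x, y) = 0`
    have hx : x * δ.det = 0 := by
      rw [Matrix.det_fin_two]; linear_combination δ 1 1 * h1 - δ 1 0 * h2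
    have hy : y * δ.det = 0 := by
      rw [Matrix.det_fin_two]; linear_combination (-(δ 0 1)) * h1 + δ 0 0 * h2
    rcases hxy with hx0 | hy0
    · exact hx0 ((mul_eq_zero.mp hx).resolve_right hδ)
    · exact hy0 ((mul_eq_zero.mp hy).resolve_right hδ)
  refine ⟨key f γ hγ, fun h ↦ ?_⟩
  have hγu : IsUnit γ.det := isUnit_iff_ne_zero.mpr hγ
  have hinv : (γ⁻¹).det ≠ 0 := isUnit_iff_ne_zero.mp (Matrix.isUnit_nonsing_inv_det_iff.mpr hγu)
  refine key (f.subst γ) γ⁻¹ hinv ?_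
  rwa [← subst_mul, Matrix.nonsing_inv_mul γ hγu, subst_one]

/-- Scaling by a nonzero square preserves solubility: `z² = μ² f(x,y)` iff `(z/μ)² = f(x,y)`.
[folklore] -/
theorem isSoluble_smul_sq_iff {K : Type*} [Field K] (f : BinaryQuartic K) {μ : K} (hμ : μ ≠ 0) :
    ((μ ^ 2) • f).IsSoluble ↔ f.IsSoluble := by
  constructor
  · rintro ⟨x, y, z, hxy, hz⟩
    refine ⟨x, y, z / μ, hxy, ?_⟩
    rw [eval_smul] at hz
    field_simp
    linear_combination hz
  · rintro ⟨x, y, z, hxy, hz⟩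
    exact ⟨x, y, μ * z, hxy, by rw [eval_smul, mul_pow, hz]⟩

/-- `PGL₂(K)`-equivalent forms are simultaneously `K`-soluble (the twisted action is a
substitution followed by scaling by the square `det(γ)⁻²`). In particular local solubility of
integral forms is a property of `PGL₂(ℚ)`-classes (Bhargava–Shankar, held arXiv text §5.1).
[cite: BhargavaShankarAnnals2015, §5.1 (arXiv:1006.1002v2 numbering)] -/
theorem PGL2Equiv.isSoluble_iff {K : Type*} [Field K] {f g : BinaryQuartic K} (h : PGL2Equiv f g) :
    g.IsSoluble ↔ f.IsSoluble := by
  obtain ⟨γ, hγ, rfl⟩ := h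
  rw [show (γ.det ^ 2)⁻¹ = (γ.det⁻¹) ^ 2 by rw [inv_pow], isSoluble_smul_sq_iff _ (inv_ne_zero hγ),
    isSoluble_subst_iff _ hγ]

/-- Definiteness of a real form is invariant under invertible real substitutions. [folklore] -/
theorem isDefinite_subst_iff (f : BinaryQuartic ℝ) {γ : Matrix (Fin 2) (Fin 2) ℝ}
    (hγ : γ.det ≠ 0) : (f.subst γ).IsDefinite ↔ f.IsDefinite := by
  -- the substitution `v ↦ v γ` maps nonzero vectors to nonzero vectors, surjectively
  have nz : ∀ (δ : Matrix (Fin 2) (Fin 2) ℝ), δ.det ≠ 0 → ∀ x y : ℝ, (x ≠ 0 ∨ y ≠ 0) →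
      (x * δ 0 0 + y * δ 1 0 ≠ 0 ∨ x * δ 0 1 + y * δ 1 1 ≠ 0) := by
    intro δ hδ x y hxy
    by_contra h0
    simp only [ne_eq, not_or, not_not] at h0
    obtain ⟨h1, h2⟩ := h0
    have hx : x * δ.det = 0 := by
      rw [Matrix.det_fin_two]; linear_combination δ 1 1 * h1 - δ 1 0 * h2
    have hy : y * δ.det = 0 := by
      rw [Matrix.det_fin_two]; linear_combination (-(δ 0 1)) * h1 + δ 0 0 * h2
    rcases hxy with hx0 | hy0
    · exact hx0 ((mul_eq_zero.mp hx).resolve_right hδ)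
    · exact hy0 ((mul_eq_zero.mp hy).resolve_right hδ)
  -- one direction for an arbitrary invertible `δ`: definiteness of `g` gives that of `g.subst δ`
  have key : ∀ (g : BinaryQuartic ℝ) (δ : Matrix (Fin 2) (Fin 2) ℝ), δ.det ≠ 0 →
      g.IsDefinite → (g.subst δ).IsDefinite := by
    rintro g δ hδ (hpos | hneg)
    · exact Or.inl fun x y hxy ↦ by rw [eval_subst]; exact hpos _ _ (nz δ hδ x y hxy)
    · exact Or.inr fun x y hxy ↦ by rw [eval_subst]; exact hneg _ _ (nz δ hδ x y hxy)
  refine ⟨fun h ↦ ?_, key f γ hγ⟩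
  have hγu : IsUnit γ.det := isUnit_iff_ne_zero.mpr hγ
  have hinv : (γ⁻¹).det ≠ 0 := isUnit_iff_ne_zero.mp (Matrix.isUnit_nonsing_inv_det_iff.mpr hγu)
  have := key (f.subst γ) γ⁻¹ hinv h
  rwa [← subst_mul, Matrix.nonsing_inv_mul γ hγu, subst_one] at this

/-- The real types `V_ℤ^{(0)}`, `V_ℤ^{(1)}`, `V_ℤ^{(2)}` are `GL₂(ℤ)`-invariant
(Bhargava–Shankar 2015, §2.1: `V_ℤ^{(i)} = V_ℝ^{(i)} ∩ V_ℤ` for the `GL₂(ℝ)`-stable `V_ℝ^{(i)}`).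
[cite: BhargavaShankarAnnals2015, §2.1] -/
theorem GL2ZEquiv.mem_noRealRoots_iff {f g : BinaryQuartic ℤ} (h : GL2ZEquiv f g) :
    g ∈ noRealRoots ↔ f ∈ noRealRoots := by
  obtain ⟨γ, hγ, rfl⟩ := h
  have hdet : (γ.map (Int.castRingHom ℝ)).det ≠ 0 := by
    rw [show γ.map (Int.castRingHom ℝ) = (Int.castRingHom ℝ).mapMatrix γ from rfl,
      ← RingHom.map_det]
    rcases Int.isUnit_iff.mp hγ with h1 | h1 <;> simp [h1]
  show ((f.subst γ).map (Int.castRingHom ℝ)).IsDefinite ↔ (f.map (Int.castRingHom ℝ)).IsDefinite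
  rw [map_subst, isDefinite_subst_iff _ hdet]

/-- `V_ℤ^{(1)}` (`Δ < 0`) is `GL₂(ℤ)`-invariant. [cite: BhargavaShankarAnnals2015, §2.1] -/
theorem GL2ZEquiv.mem_twoRealRoots_iff {f g : BinaryQuartic ℤ} (h : GL2ZEquiv f g) :
    g ∈ twoRealRoots ↔ f ∈ twoRealRoots := by
  show g.disc < 0 ↔ f.disc < 0
  rw [h.disc_eq]

/-- `V_ℤ^{(0)}` (`Δ > 0`, indefinite) is `GL₂(ℤ)`-invariant. [cite: BhargavaShankarAnnals2015, §2.1] -/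
theorem GL2ZEquiv.mem_fourRealRoots_iff {f g : BinaryQuartic ℤ} (h : GL2ZEquiv f g) :
    g ∈ fourRealRoots ↔ f ∈ fourRealRoots := by
  have h1 := h.mem_noRealRoots_iff
  simp only [noRealRoots, Set.mem_setOf_eq] at h1
  simp only [fourRealRoots, Set.mem_setOf_eq, h.disc_eq, h1]

/-- Local solubility of integral forms is `GL₂(ℤ)`-invariant. [cite: BhargavaShankarAnnals2015, §5.1 (arXiv:1006.1002v2 numbering)] -/
theorem GL2ZEquiv.isLocallySoluble_iff {f g : BinaryQuartic ℤ} (h : GL2ZEquiv f g) :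
    g.IsLocallySoluble ↔ f.IsLocallySoluble := by
  obtain ⟨γ, hγ, rfl⟩ := h
  have hdet : ∀ {K : Type} [Field K], ((γ.map (Int.castRingHom K)).det ≠ 0) := by
    intro K _
    rw [show γ.map (Int.castRingHom K) = (Int.castRingHom K).mapMatrix γ from rfl,
      ← RingHom.map_det]
    rcases Int.isUnit_iff.mp hγ with h1 | h1 <;> simp [h1]
  simp only [IsLocallySoluble, map_subst]
  rw [isSoluble_subst_iff _ hdet]
  refine and_congr_right fun _ ↦ forall_congr' fun p ↦ forall_congr' fun _ ↦ ?_
  rw [isSoluble_subst_iff _ hdet]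

end BinaryQuartic


namespace BinaryQuartic

/-! ## The quartic of the identity `2`-Selmer class of `E_{A,B}` -/

/-- The (reducible) integral quartic `4y(x³ + A x y² + B y³) = 4x³y + 4A xy³ + 4B y⁴` has
invariants `I = 2⁴ · (−3A) = 2⁴ I(E_{A,B})` and `J = 2⁶ · (−27B) = 2⁶ J(E_{A,B})`: it represents the
identity class in Bhargava–Shankar's parametrization of `S₂(E_{A,B})` (held arXiv text, §2.4
p. 12: `q_{I,J} = x³y − (I/3)xy³ − (J/27)y⁴` has invariants `I`, `J`; §5.1), so the set of forms
in `Literature.NumberTheory.EllipticCurves.bhargavaShankar_card_selmerTwo_eq` is nonempty. [cite: BhargavaShankarAnnals2015, §2.4 p. 12 (the forms q_{I,J}; arXiv:1006.1002v2 numbering)] -/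
theorem invariants_identityQuartic (A B : ℤ) :
    (⟨0, 4, 0, 4 * A, 4 * B⟩ : BinaryQuartic ℤ).I = 2 ^ 4 * (-3 * A) ∧
      (⟨0, 4, 0, 4 * A, 4 * B⟩ : BinaryQuartic ℤ).J = 2 ^ 6 * (-27 * B) := by
  constructor
  · simp only [I]; ring
  · simp only [J]; ring

end BinaryQuartic

end Literature.NumberTheory.EllipticCurves

end
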